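import Literature.NumberTheory.Automorphic.Liu2021.Def411WeilCarriersAtLineCoinv
import HarnessLib

/-!
# [Liu2021, Def. 4.11]'s carrier at TWO LINES: transport of `ω(μ, ε, χ)` from `⟨a⟩` to `⟨a′⟩` along a `FinSB`-intertwiner

Topic `NumberTheory/Automorphic/Liu2021`; namespace `Literature.NumberTheory.Automorphic.Liu2021.Def411WeilCarriers` (sequel of ★
`Def411WeilCarriersAtLineCoinv` and ★ `Def411WeilCarriersAtLineTransport`).  THEOREMS ONLY (no definition, no named fact, no instance, no
`sorry`).  Cell `hodgecm-mathlib`, FLOOR-0 P4 ∕ P2: the TOP brick (T0) of the line-class transport `lineClassTransport_equiv`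
(stub S4a `StubT3aLineTransportAt` of `Cruxes/H413/Lines/F0_P4AdmissibleOccursInH1.lean`, letter (C′) `rhoAtLine_lineClassTransport` of P2;
A-p17 (g12) `LT-roadmap.v2` ed10aabf).

SETTING.  `E/F` CM-type quadratic data `(c, δ, d)`, a rank-`N` hermitian form `J_V = T_V ⊗ 1`, index equivalence `e`, and a FAMILY of
compatible pair splittings `s b : U(J_V)(𝔸) × U(⟨b⟩)(𝔸) →* Mp_ψ(𝕎_b)ᶜᵒⁿᵗ` over the hermitian LINES `⟨b⟩ = J_W b`, `b ∈ F^×` (`hs`); the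
carrier `omegaAtLine … hs b χ = Coinv (finPairRepW[b]) (lineChar b χ)` with its `U(J_V)(𝔸_{F,f})`-action `rhoVAtLine … b χ`
(★ `Def411WeilCarriersAtLine`).  The two ★ transport lemmas of `Def411WeilCarriersAtLineTransport` move the `V`-FORM at ONE line; this
file moves the LINE: two `W`-forms `⟨a⟩`, `⟨a′⟩` (two Gram data, two `W`-groups `U(⟨a⟩)(𝔸_f) ≠ U(⟨a′⟩)(𝔸_f)`), read through the common
norm-one torus `E¹(𝔸_{F,f})` by ★ `lineCenterEquiv` ∕ ★ `coinvLineCenterEquiv`.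

* **`exists_omegaAtLine_equiv_rhoVAtLine_of_twoLines`** — a linear automorphism `Q` of `𝒮((𝔸_F^∞)^{N})` intertwining ON THE NOSE the
  `U(J_V)`-members `finPairRepV[a]`, `finPairRepV[a′]` and the `W`-members read through `E¹(𝔸_f)` (`finPairRepW[b] ∘ lineCenterEquiv b`)
  descends to `Ψ : omegaAtLine … a χ ≃ₗ[ℂ] omegaAtLine … a′ χ`, `Ψ [f] = [Q f]`, with `Ψ (rhoVAtLine a χ k x) = rhoVAtLine a′ χ k (Ψ x)`:
  `Ψ := coinvLineCenterEquiv a′ ∘ TwistedCoinv.mapEquiv Q 1 ∘ (coinvLineCenterEquiv a)⁻¹` — functoriality of the maximal `χ`-quotient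
  ([GelbartRogawski1991] §3.1 Remark p. 457).  **`…_of_twoLines_smul`** — the same when `Q` intertwines the `U(J_V)`-members up to a
  scalar function `λ k` (conclusion `Ψ (rhoVAtLine a χ k x) = λ k • rhoVAtLine a′ χ k (Ψ x)`, the `(Ψ, λ)` shape of the P4 capstone
  ★ `ThetaJunction.exists_holReal_of_transport`).

HC_CM is proved only modulo the 7 printed citations until rung 0 closes; this file proves nothing about them.

## References
* [Liu2021] Y. Liu, *Fourier–Jacobi cycles and arithmetic relative trace formula*, Camb. J. Math. 9 (2021) = arXiv:2102.11518: Def. 4.11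
  (l. 2092–2096), Def. 4.12 (l. 2105), App. D §D.1 Step 1 footnote (l. 5215), Step 3 (l. 5221).
* [GelbartRogawski1991] S. Gelbart, J. Rogawski, Invent. Math. 105 (1991), §3.1 Prop. 3.1.1 p. 455, Remark p. 457 L4–13.
-/

set_option autoImplicit false

noncomputable section

namespace Literature.NumberTheory.Automorphic.Liu2021.Def411WeilCarriers

open Literature.NumberTheory.Automorphic Literature.NumberTheory.Automorphic.UnitaryGroup
open Literature.NumberTheory.GelbartRogawski1991 Literature.NumberTheory.GelbartRogawski1991.UnitaryDualPair
open Literature.NumberTheory.GelbartRogawski1991.UnitaryDualPair.WeilCoinv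
open Literature.NumberTheory.Weil1964 Literature.RepresentationTheory

section TwoLines

variable (F E : Type) [Field F] [NumberField F] [Field E] [NumberField E] [Algebra F E]
variable (c : E ≃ₐ[F] E) (N : ℕ) {n : ℕ} (e : Fin N × Fin 1 ≃ Fin n)
variable (JV : Matrix (Fin N) (Fin N) E) {TV : Matrix (Fin N) (Fin N) F}
variable [Algebra.IsQuadraticExtension F E] {δ : E} (hcδ : c δ = -δ) (hδ : δ ≠ 0) {d : F}
  (hd : δ * δ = algebraMap F E d) (hV : TV.IsSymm) (hVd : IsUnit TV.det) (hJV : JV = TV.map (algebraMap F E))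
variable {s : ∀ a : Fˣ, UnitaryGroup.adelicPair F E c N 1 JV (JW F E a) →* adelicMpCont F (Fin n) (adelicGram F e TV (TW F a))}
  (hs : ∀ a : Fˣ, (splittingDatum F E c N 1 e JV (JW F E a) hcδ hδ hd hV (isSymm_TW F a) hVd (isUnit_det_TW F a) hJV
    (JW_eq F E a)).IsCompatible (s a))
variable (a a' : Fˣ) (χ : Chi F E c) (Q : FinSB F (Fin N × Fin 1) ≃ₗ[ℂ] FinSB F (Fin N × Fin 1))
  (hQW : ∀ (u : UnitaryGroup.finAdelicOne F E c) (f : FinSB F (Fin N × Fin 1)),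
    finPairRepW F E c N 1 e JV (JW F E a') hcδ hδ hd hV (isSymm_TW F a') hVd (isUnit_det_TW F a') hJV (JW_eq F E a') (hs a')
        (lineCenterEquiv F E c a' u) (Q f) =
      Q (finPairRepW F E c N 1 e JV (JW F E a) hcδ hδ hd hV (isSymm_TW F a) hVd (isUnit_det_TW F a) hJV (JW_eq F E a) (hs a)
        (lineCenterEquiv F E c a u) f))

include hQW in
/-- **transport of `ω(μ, ε, χ)` between two LINES along a `FinSB`-intertwiner, up to scalars on `U(J_V)`**: if `Q` intertwines the
`W`-members read through `E¹(𝔸_f)` on the nose and the `U(J_V)`-members up to a scalar `λ k` (`finPairRepV[a′] k (Q f) = λ k • Q (finPairRepV[a] k f)`),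
then `Ψ [f] = [Q f]` is a linear equivalence `omegaAtLine … a χ ≃ₗ[ℂ] omegaAtLine … a′ χ` with
`rhoVAtLine a′ χ k (Ψ x) = λ k • Ψ (rhoVAtLine a χ k x)` (the `(Ψ, λ)` shape consumed by the P4 capstone).
[cite: GelbartRogawski1991, §3.1 Remark p. 457 L4–13] [cite: Liu2021, Def. 4.11 (l. 2092–2096); App. D §D.1 Step 1 footnote (l. 5215)] -/
theorem exists_omegaAtLine_equiv_rhoVAtLine_of_twoLines_smul (lam : UnitaryGroup.finAdelic F E c N JV → ℂ)
    (hQV : ∀ (k : UnitaryGroup.finAdelic F E c N JV) (f : FinSB F (Fin N × Fin 1)),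
      finPairRepV F E c N 1 e JV (JW F E a') hcδ hδ hd hV (isSymm_TW F a') hVd (isUnit_det_TW F a') hJV (JW_eq F E a') (hs a')
          k (Q f) =
        lam k • Q (finPairRepV F E c N 1 e JV (JW F E a) hcδ hδ hd hV (isSymm_TW F a) hVd (isUnit_det_TW F a) hJV (JW_eq F E a)
          (hs a) k f)) :
    ∃ Ψ : omegaAtLine F E c N e JV hcδ hδ hd hV hVd hJV hs a χ ≃ₗ[ℂ] omegaAtLine F E c N e JV hcδ hδ hd hV hVd hJV hs a' χ,
      (∀ f : FinSB F (Fin N × Fin 1),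
        Ψ (TwistedCoinv.mk _ (lineChar F E c a χ.1) f) = TwistedCoinv.mk _ (lineChar F E c a' χ.1) (Q f)) ∧
      ∀ (k : UnitaryGroup.finAdelic F E c N JV) (x : omegaAtLine F E c N e JV hcδ hδ hd hV hVd hJV hs a χ),
        rhoVAtLine F E c N e JV hcδ hδ hd hV hVd hJV hs a' χ k (Ψ x) =
          lam k • Ψ (rhoVAtLine F E c N e JV hcδ hδ hd hV hVd hJV hs a χ k x) := by
  have hT : ∀ (u : UnitaryGroup.finAdelicOne F E c) (v : FinSB F (Fin N × Fin 1)),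
      ((finPairRepW F E c N 1 e JV (JW F E a') hcδ hδ hd hV (isSymm_TW F a') hVd (isUnit_det_TW F a') hJV (JW_eq F E a')
          (hs a')).comp (lineCenterEquiv F E c a').toMonoidHom) u (Q v) =
        (((1 : UnitaryGroup.finAdelicOne F E c → ℂˣ) u : ℂˣ) : ℂ) •
          Q (((finPairRepW F E c N 1 e JV (JW F E a) hcδ hδ hd hV (isSymm_TW F a) hVd (isUnit_det_TW F a) hJV (JW_eq F E a)
            (hs a)).comp (lineCenterEquiv F E c a).toMonoidHom) u v) := fun u v => by
    rw [Pi.one_apply, Units.val_one, one_smul]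
    exact hQW u v
  have hχ : ∀ u : UnitaryGroup.finAdelicOne F E c, χ.1 u = (1 : UnitaryGroup.finAdelicOne F E c → ℂˣ) u * χ.1 u := fun u => by
    rw [Pi.one_apply, one_mul]
  let M := TwistedCoinv.mapEquiv _ χ.1 _ χ.1 Q 1 hT hχ
  let Ca := coinvLineCenterEquiv F E c N e JV hcδ hδ hd hV hVd hJV hs a χ
  let Ca' := coinvLineCenterEquiv F E c N e JV hcδ hδ hd hV hVd hJV hs a' χ
  refine ⟨(Ca.symm.trans M).trans Ca', fun f => ?_, fun k x => ?_⟩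
  · simp only [LinearEquiv.trans_apply, Ca, Ca', M, coinvLineCenterEquiv_symm_mk, TwistedCoinv.mapEquiv_mk,
      coinvLineCenterEquiv_mk]
  · simp only [LinearEquiv.trans_apply]
    have h1 := coinvLineCenterEquiv_symm_rep F E c N e JV hcδ hδ hd hV hVd hJV hs a χ k x
    have h2 := TwistedCoinv.mapEquiv_rep _ χ.1 _ χ.1 _ _
      (commute_finPairRepV_finPairRepW_comp_lineCenterEquiv F E c N e JV hcδ hδ hd hV hVd hJV hs a)
      (commute_finPairRepV_finPairRepW_comp_lineCenterEquiv F E c N e JV hcδ hδ hd hV hVd hJV hs a') Q 1 hT hχ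
      (g := k) (g' := k) (a := lam k) (fun f => hQV k f) (Ca.symm x)
    rw [h1, ← coinvLineCenterEquiv_rep, h2, map_smul]

include hQW in
/-- **transport of `ω(μ, ε, χ)` between two LINES along a `FinSB`-intertwiner** (on the nose): if `Q` intertwines the `U(J_V)`-members
`finPairRepV[a]`, `finPairRepV[a′]` and the `W`-members read through `E¹(𝔸_f)`, then `Ψ [f] = [Q f]` is a linear equivalence
`omegaAtLine … a χ ≃ₗ[ℂ] omegaAtLine … a′ χ` with `Ψ (rhoVAtLine a χ k x) = rhoVAtLine a′ χ k (Ψ x)` — the functoriality of the maximal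
`χ`-quotient under `Q` (`coinvLineCenterEquiv a′ ∘ TwistedCoinv.mapEquiv Q 1 ∘ (coinvLineCenterEquiv a)⁻¹`).
[cite: GelbartRogawski1991, §3.1 Remark p. 457 L4–13] [cite: Liu2021, Def. 4.11 (l. 2092–2096); App. D §D.1 Step 1 footnote (l. 5215), Step 3 (l. 5221)] -/
theorem exists_omegaAtLine_equiv_rhoVAtLine_of_twoLines
    (hQV : ∀ (k : UnitaryGroup.finAdelic F E c N JV) (f : FinSB F (Fin N × Fin 1)),
      finPairRepV F E c N 1 e JV (JW F E a') hcδ hδ hd hV (isSymm_TW F a') hVd (isUnit_det_TW F a') hJV (JW_eq F E a') (hs a')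
          k (Q f) =
        Q (finPairRepV F E c N 1 e JV (JW F E a) hcδ hδ hd hV (isSymm_TW F a) hVd (isUnit_det_TW F a) hJV (JW_eq F E a)
          (hs a) k f)) :
    ∃ Ψ : omegaAtLine F E c N e JV hcδ hδ hd hV hVd hJV hs a χ ≃ₗ[ℂ] omegaAtLine F E c N e JV hcδ hδ hd hV hVd hJV hs a' χ,
      (∀ f : FinSB F (Fin N × Fin 1),
        Ψ (TwistedCoinv.mk _ (lineChar F E c a χ.1) f) = TwistedCoinv.mk _ (lineChar F E c a' χ.1) (Q f)) ∧
      ∀ (k : UnitaryGroup.finAdelic F E c N JV) (x : omegaAtLine F E c N e JV hcδ hδ hd hV hVd hJV hs a χ),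
        Ψ (rhoVAtLine F E c N e JV hcδ hδ hd hV hVd hJV hs a χ k x) =
          rhoVAtLine F E c N e JV hcδ hδ hd hV hVd hJV hs a' χ k (Ψ x) := by
  obtain ⟨Ψ, hmk, hΨ⟩ := exists_omegaAtLine_equiv_rhoVAtLine_of_twoLines_smul F E c N e JV hcδ hδ hd hV hVd hJV hs a a' χ Q hQW
    (fun _ => 1) (fun k f => by rw [one_smul]; exact hQV k f)
  exact ⟨Ψ, hmk, fun k x => by rw [hΨ, one_smul]⟩

end TwoLines

end Literature.NumberTheory.Automorphic.Liu2021.Def411WeilCarriers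

end
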